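import Summits.ResolutionOfSingularities.ResolutionOfSingularities.Theorems.UniversalCellsDefs

/-!
# Route UniversalCells — crux `Universality` (stmt-ResolutionOfSingularities-15234), line `birth`:
# stub `stub_affinePresentation`

AFFINE CHARTS OF FINITE PRESENTATION. Let `Y` be a scheme locally of finite type over
`Spec (ZMod p)` (`p` prime) and `y ∈ Y`. Then `y` lies in an affine open `U ⊆ Y` whose coordinate
ring is a finitely presented `𝔽_p`-algebra: `Γ(Y, U) ≃+* 𝔽_p[x_1, …, x_n] ⧸ ⟨S⟩` with `S` finite.

Proof (pure Mathlib plumbing): pick any affine open `U ∋ y`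
(`exists_isAffineOpen_mem_and_subset`); by definition of `LocallyOfFiniteType` the ring map
`Γ(Spec 𝔽_p, ⊤) → Γ(Y, U)` (`f.appLE ⊤ U _`) is of finite type, hence so is its composite `g` with
`𝔽_p ≅ Γ(Spec 𝔽_p, ⊤)` (`Scheme.ΓSpecIso`); `𝔽_p` is a field, so Noetherian, so `g` is of finite
presentation (`RingHom.FinitePresentation.of_finiteType`), i.e. there is a surjection
`φ : 𝔽_p[x_1, …, x_n] → Γ(Y, U)` with finitely generated kernel `⟨S⟩`; conclude with the first
isomorphism theorem (`Ideal.quotientKerAlgEquivOfSurjective`).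
[cite: StacksProject, Tag 01TO (locally of finite type), Tag 00FP (finite type over a Noetherian
ring is of finite presentation)]
-/

-- single-problem summit: the doubled namespace component `ResolutionOfSingularities` is forced
set_option linter.dupNamespace false

noncomputable section

open CategoryTheory AlgebraicGeometry

namespace Summit.ResolutionOfSingularities.ResolutionOfSingularities.Theorems.UniversalCells

/-- AFFINE CHARTS OF FINITE PRESENTATION: every point of a scheme locally of finite type over
`Spec (ZMod p)` lies in an affine open whose coordinate ring is `(ZMod p)[x_1, …, x_n] ⧸ ⟨S⟩` for a
finite set `S` of polynomials. [cite: StacksProject, Tag 01TO (locally of finite type), Tag 00FP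
(finite type over Noetherian is finite presentation)] -/
theorem stub_affinePresentation (p : ℕ) (hp : p.Prime) (Y : Scheme.{0}) (f : Y ⟶ Spec (.of (ZMod p))) (hf : LocallyOfFiniteType f) (y : Y) : ∃ U : Y.Opens, IsAffineOpen U ∧ y ∈ U ∧ ∃ (n : ℕ) (S : Finset (MvPolynomial (Fin n) (ZMod p))), Nonempty (Γ(Y, U) ≃+* MvPolynomial (Fin n) (ZMod p) ⧸ Ideal.span (↑S : Set (MvPolynomial (Fin n) (ZMod p)))) := by
  haveI : Fact p.Prime := ⟨hp⟩
  -- (1) an affine open neighbourhood of `y`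
  obtain ⟨U, hU, hyU, -⟩ :=
    exists_isAffineOpen_mem_and_subset (X := Y) (x := y) (U := ⊤) (Set.mem_univ y)
  refine ⟨U, hU, hyU, ?_⟩
  -- (2) the ring map `Γ(Spec 𝔽_p, ⊤) → Γ(Y, U)` is of finite type
  have h1 : (f.appLE ⊤ U le_top).hom.FiniteType :=
    hf.finiteType_appLE (isAffineOpen_top _) hU le_top
  -- (3) compose with `𝔽_p ≅ Γ(Spec 𝔽_p, ⊤)`
  let e : ZMod p ≃+* Γ(Spec (.of (ZMod p)), ⊤) :=
    (Scheme.ΓSpecIso (.of (ZMod p))).commRingCatIsoToRingEquiv.symm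
  let g : ZMod p →+* Γ(Y, U) := (f.appLE ⊤ U le_top).hom.comp e.toRingHom
  have h2 : g.FiniteType := h1.comp (RingHom.FiniteType.of_surjective _ e.surjective)
  -- (4) finite type over the Noetherian ring `𝔽_p` is finite presentation
  have h3 : g.FinitePresentation := RingHom.FinitePresentation.of_finiteType.mp h2
  letI : Algebra (ZMod p) Γ(Y, U) := g.toAlgebra
  have h4 : Algebra.FinitePresentation (ZMod p) Γ(Y, U) := h3
  obtain ⟨n, φ, hφ, S, hS⟩ := h4.out
  -- (5) first isomorphism theorem
  exact ⟨n, S, ⟨(Ideal.quotientKerAlgEquivOfSurjective hφ).symm.toRingEquiv.trans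
    (Ideal.quotEquivOfEq hS.symm)⟩⟩

end Summit.ResolutionOfSingularities.ResolutionOfSingularities.Theorems.UniversalCells

end
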